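import Summits.Langlands.Langlands.Theorems.IrreducibilityBySelfDualityGaloisRepGL2CMaeFirstLemma
import Summits.Langlands.Langlands.Theorems.IrreducibilityBySelfDualityGaloisRepGL2CMaeThm713Step
import Summits.Langlands.Langlands.Theorems.IrreducibilityBySelfDualityGaloisRepGL2CMaePatching
import Literature.NumberTheory.Automorphic.BaseChangeStrongCuspidalPrime
import Literature.NumberTheory.Automorphic.UnitaryCoherentGaloisRep
import Literature.NumberTheory.Automorphic.HarrisLanTaylorThorneCor627
import Literature.NumberTheory.Automorphic.ReciprocityGLnProofs
import Mathlib.RingTheory.MvPolynomial.Basic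
import HarnessLib
import Literature.NumberTheory.Automorphic.HarrisLanTaylorThorneTwistedPairLimit

/-!
# `GaloisRepGL2CMae` (stmt-Langlands-16722) from four named facts: HLTT §6 at `n = 2`, HLTT Cor. 1.3,
# and Arthur–Clozel's two base-change clauses

Conditional closure of the crux line `Cruxes/GaloisRepGL2CMae/Lines/Sketch.lean` (`--supports
stmt-Langlands-16722`).  The three glue stubs of the line are LANDED theorems
(`GaloisRepGL2CMae.stub_firstLemma`, `.stub_thm713`, `.stub_patching`); the four remaining stubs are
printed theorems, two of which are already named facts of the tree
(`ArthurClozel1989_strongLifting_archimedean`, `ArthurClozel1989_strongLifting_cuspidal`, instantiated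
at `n = 2`) and two of which are stated here, inline, for relocation to `Literature/` by the gate:

* `HarrisLanTaylorThorne2016_twistedPairLimit_two` — (α)₂, Harris–Lan–Taylor–Thorne 2016 §6 at
  `n = 2` WITHOUT its Galois-theoretic inputs (Cor. 1.3 and pseudo-representations): the twisted-pair
  Frobenius prescription of Cor. 6.26/6.27 is an algebra-valued `p`-adic limit of base-change Satake
  polynomials of cuspidal automorphic representations of the quasi-split unitary group in `4`
  variables with regular discrete series at infinity;
* `HarrisLanTaylorThorne2016_corollary13_cuspidalUnitary` — (β′), Harris–Lan–Taylor–Thorne 2016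
  Cor. 1.3 (second alternative) for cuspidal automorphic representations of the quasi-split unitary
  group in `2n` variables with regular discrete series at infinity.

`galoisRepGL2CMae_of_facts` then proves the crux body from the four facts in one line.

References: M. Harris, K.-W. Lan, R. Taylor, J. Thorne, *On the rigid cohomology of certain Shimura
varieties*, Res. Math. Sci. 3:37 (2016) [HarrisLanTaylorThorneRMS2016] (arXiv:1411.6717: §1 p. 8,
Prop. 1.2–Cor. 1.3 p. 14, §1.3 pp. 13–14, §6.1 pp. 89–91, Cor. 6.23–6.27 pp. 100–101, proof of
Thm. 7.13 p. 104); J. Arthur, L. Clozel, Ann. of Math. Stud. 120 (1989), Ch. 3 [ArthurClozelAMS120];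
N. Fakhruddin, V. Pilloni (2021) §9.2 [FakhruddinPilloni2021]; C. P. Mok, Mem. AMS 235 (2015) /
Compos. Math. 150 (2014) (quasi-split unitary groups) [Mok2014].
-/

noncomputable section

set_option linter.dupNamespace false -- project-wide option; `Summit.Langlands.Langlands` is the mandated namespace (D-0017)

open scoped MatrixGroups Matrix NumberField Polynomial
open NumberField IsDedekindDomain Field Polynomial Filter
open Literature.NumberTheory.Automorphic Literature.NumberTheory.GaloisRepresentations
open Literature.NumberTheory.Automorphic.HarrisLanTaylorThorne2016

namespace Literature.NumberTheory.Automorphic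

end Literature.NumberTheory.Automorphic

namespace Summit.Langlands.Langlands.Theorems.GaloisRepGL2CMae

/-- **The crux `GaloisRepGL2CMae` (Harris–Lan–Taylor–Thorne Thm. A for `GL₂` over CM fields, almost
everywhere) from four named facts** — HLTT §6 at `n = 2` (automorphic half,
`HarrisLanTaylorThorne2016_twistedPairLimit_two`), HLTT Cor. 1.3 (cuspidal unitary, regular discrete
series, `HarrisLanTaylorThorne2016_corollary13_cuspidalUnitary`), and Arthur–Clozel's archimedean clause
and strong cuspidal prime-degree base change (`ArthurClozel1989_strongLifting_archimedean`,
`ArthurClozel1989_strongLifting_cuspidal`, used at `n = 2`) — through the three LANDED glue theorems of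
the crux line `Sketch`: `stub_firstLemma` (Cor. 6.27 at `n = 2` by the proved algebra-valued limit
theorem), `stub_thm713` (Thm. 7.13 at `n = 2` by the proved Prop. 7.12 engine) and `stub_patching`
(Cor. 7.14 at `n = 2`, almost everywhere, by proved Sorensen patching).  The conclusion is the body of
the route decl `Summit.Langlands.Langlands.Theses.IrreducibilityBySelfDuality.GaloisRepGL2CMae`
(item stmt-Langlands-16722) verbatim.
[cite: HarrisLanTaylorThorneRMS2016, Thm. A (p. 3), Cor. 1.3 (p. 31), §6 and Cor. 6.27 (p. 225), Thm. 7.13–Cor. 7.14 (p. 232)]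
[cite: ArthurClozelAMS120, Ch. 3 Thm. 4.2 (a), Thm. 5.1] -/
theorem galoisRepGL2CMae_of_facts :
    Literature.NumberTheory.Automorphic.HarrisLanTaylorThorne2016_twistedPairLimit_two →
    Literature.NumberTheory.Automorphic.HarrisLanTaylorThorne2016_corollary13_cuspidalUnitary →
    Literature.NumberTheory.Automorphic.ArthurClozel1989_strongLifting_archimedean →
    Literature.NumberTheory.Automorphic.ArthurClozel1989_strongLifting_cuspidal →
    ∀ (K : Type) [Field K] [NumberField K]
      (hcpt₂ : Literature.NumberTheory.Automorphic.isCompact_glFiniteIntegralLevel 2 K),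
      NumberField.IsCMField K →
      ∀ (σ : Literature.NumberTheory.Automorphic.CuspidalAutomorphicRepData 2 K hcpt₂),
      σ.1.IsRegularAlgebraic → ∀ (ℓ : ℕ) [Fact ℓ.Prime] (ι : PadicAlgCl ℓ ≃+* ℂ),
      ∃ ρ : Literature.NumberTheory.GaloisRepresentations.FramedGaloisRep K (PadicAlgCl ℓ) 2,
        ∀ᶠ v : IsDedekindDomain.HeightOneSpectrum (NumberField.RingOfIntegers K) in Filter.cofinite,
          ∀ β : Multiset ℂ, σ.1.HasSatakeParamAt v β →
            ρ.IsUnramifiedAt v ∧ ρ.HasFrobCharpolyAt v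
              (Literature.NumberTheory.Automorphic.arithFrobPolyOfSatake ι v.residueCard 2 β) :=
  fun hα hβ harch hBC ↦
  stub_patching (stub_thm713 (stub_firstLemma hα hβ)) (fun F E _ _ _ _ _ _ ↦ harch 2 F E) (hBC 2)

end Summit.Langlands.Langlands.Theorems.GaloisRepGL2CMae

end
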